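import Mathlib.Analysis.SpecialFunctions.Exp
import Literature.MathematicalPhysics.QuantumFieldTheory.Balaban1983to89.B15BasicStep
import Literature.MathematicalPhysics.QuantumFieldTheory.Balaban1983to89.B15PrelimIntegrations
import Literature.MathematicalPhysics.QuantumFieldTheory.Balaban1983to89.B15HDecayLeaves

/-!
# N21 (NE7c) · DICTIONARY: the exterior-profile letter of the dilation road = [B15] (1.45) ∧ (1.47) AS PRINTED, by name
# (lens v31.0 §B ∕ ROW P⁗‴)

R134 seat pub-ymgap-dag-n21-d (g8), node N21 = NE7c (single-run shell-weight bound, NOT PRINTED in [Bałaban 1983–89],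
NOT proved), lane K3⁷ `SpineGivenEndpointR13SepCoPH` (stmt-QuantumFields-20544, `--kind proof --supports … --as helper`).
Part 38 of the comparison series.  THIS FILE = §B of the lens's `Sketch-nearmiss-g31.lean` (LENS-nearmiss v31.0 CLOSE-OUT, ROW P⁗‴, idle
row «any n21 seat») — farm rc 0 · 0 warnings at the lens desk — VERBATIM, statements and proofs, re-homed in this namespace.
AUTHORSHIP OF THE MATHEMATICS: planner seat `ym-lens-BalabanUVNodes-nearmiss` g31; this seat only files.

WHAT (lens v31 §B; desk ROW Q″ answered AS PRINTED, lit-balaban iface-1 l.23802 + lead l.23815).  The lens's «profile letter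
at an old layer of scale gap `a`» — the located exterior input of the re-centred dilation road (parts 27–36: the row sums
`Λ_b = Σ_y |A_by| Θ_y`) — is the composition of the tree's PRINTED rows [B15] = Bałaban CMP 122 (1989) (1.45) ∧ (1.47)
(`B15.PrelimIntegrations.Ineq145` ∕ `Ineq147`, kernel-checked in `Literature/…/Balaban1983to89/B15PrelimIntegrations.lean`):
`profile_oldLayer_of_ineq145_147`, `profile_oldLayer_geometric`, and the history bound `relativeTilt_history_le`.  No
restatement of the printed rows — they are cited BY NAME as hypotheses of the stated shape.

THE DICTIONARY lens ↔ print ↔ tree (lens v31.0 N212 ∕ Card 91, reproduced as the citation table of this file; every tree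
name below is an EXISTING kernel-checked decl under `Literature/…/Balaban1983to89/`, cited BY NAME, nothing restated):
* `z_y, Θ_y` (exterior variable, permitted size) ↔ «the field in the argument of ℍ» by region ([B15] p.185 ¶1; (1.30)
  `B15StandardRep.Rep130`, (1.44) `Rep144`);
* `Σ_y A_by z_y` (linear response at `b`) ↔ `ℍ^{(j)}(b)`, `ℍ^{(n)}_{k,Z}` via (1.37) `B15.PrelimIntegrations.Ineq137`
  (`|e^{iℍ} − 1| ≤ O(1)L·sup|ℍ|`, head `B15Ineq137Proof.ineq137_of_164`);
* `|A_by| ≤ Γ₀e^{−δ|b−y|}` (desk ROW Q′) ↔ «the exponential decay property of `ℍ_{j,□}`», letters `(B₃, δ)` of [12]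
  (106)–(108), (159)–(163) ∕ [14] (1.65) (`B15HDecayLeaves.ineq138_first_of_ineq190`, `ineq145_of_ineq190`);
* `Λ_b = Σ_y |A_by| Θ_y` ↔ the right sides of (1.38) (same step), (1.42) (fluctuation), `(L^iη)^{−1}`×(1.45) (old layer `i`)
  with (1.47) (`Ineq138` ∕ `Ineq142` ∕ `Ineq145` ∕ `Ineq147`; composed HERE: `profile_oldLayer_of_ineq145_147`, `_geometric`);
* `θ_b` ↔ `δ_j` (links: (1.39) ∕ (1.43)) resp. `(1 − β(1 − 2^{−(j−i+1)}))L₀^{2max{0,i−k₀−1}}ε_i(L^{k−i}η)²` (plaquettes: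
  `B15.BasicStep.SF149` ∕ `SF151`); the history sum in the (1.48) currency is `relativeTilt_history_le` HERE;
* «(M1) holds with `D = O(x_b²)`» ↔ CONTAINMENT WITH SLACK: old χ = 1 on the support of the new χ's ((1.29)
  `claim129_assembly`), mass-free.  The tree's SHELL of relative width `ρ_j` (`T4ShellMeasure` §5) has NO printed
  counterpart (print evaluates the old χ at the exact (1.44) configurations) — which is exactly why NE7c is «NOT PRINTED»;
  the printed slack entered the tree as threshold freedom `κ_a ≤ (3∕8)β·β2^{−(a+2)}` (part 25 `…N21DilationAgeWindow`,
  `T4LipschitzCutoff` §5∕§7).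

HONEST FRAMING.  [textbook] ∕ by-name bookkeeping; 0 def, 0 sorry; nothing of Bałaban's asserted; NE7c NOT PRINTED ∕ NOT proved; N21 NOT
discharged; counts unmoved (typed 28∕28 · discharged 5∕27); count-neutral; one finite 𝕋⁴ at fixed ε — nothing about ℝ⁴ ∕ OS ∕ mass gap ∕ Clay.
-/

namespace Summit.QuantumFields.YangMills.Theorems.N21PrintedProfileDictionary

/-! ## §B  Dictionary: the lens's old-layer profile letter = [B15] (1.45) ∧ (1.47), AS PRINTED (tree rows by name) -/
section Dictionary

open Literature.MathematicalPhysics.QuantumFieldTheory.Balaban1983to89.B15.PrelimIntegrations (Ineq145 Ineq147)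

/-- **OLD-LAYER PROFILE LETTER, AS PRINTED.**  (1.45) `sup_{B^i(y)} L^iη|ℍ^{(n)}_{k,Z}| ≤ B₃e^{−δd(y,Ω^c_{j+1}∖Z″_{j+1})}·4δ′_j`
(and the same for `(L^iη)²|∇ℍ|`) with (1.47) `e^{−δd} ≤ e^{−δ(M∕M₁)(j−i)}` gives the lens's «kernel letter × seam letter ×
decay in the SCALE GAP»: `sH, sDH ≤ B₃·e^{−δ(M∕M₁)(j−i)}·4δ′_j`.  Inputs are the tree's typed rows `Ineq145` (head PROVED
from [15] (190): `B15HDecayLeaves.ineq145_of_ineq190`) and `Ineq147` (`ineq147_of_dist`); nothing new is asserted.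
[cite: Balaban1989LargeFieldI, (1.45)–(1.47) p.186] [bookkeeping] -/
theorem profile_oldLayer_of_ineq145_147 {sH sDH B₃ δ dist δ'j M M₁ gap : ℝ} (hB : 0 ≤ B₃) (hδ' : 0 ≤ δ'j)
    (h145 : Ineq145 sH sDH B₃ δ dist δ'j) (h147 : Ineq147 δ dist M M₁ gap) :
    sH ≤ B₃ * Real.exp (-(δ * (M / M₁) * gap)) * (4 * δ'j)
      ∧ sDH ≤ B₃ * Real.exp (-(δ * (M / M₁) * gap)) * (4 * δ'j) := by
  unfold Ineq145 at h145
  unfold Ineq147 at h147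
  have hmono : B₃ * Real.exp (-(δ * dist)) * (4 * δ'j) ≤ B₃ * Real.exp (-(δ * (M / M₁) * gap)) * (4 * δ'j) :=
    mul_le_mul_of_nonneg_right (mul_le_mul_of_nonneg_left h147 hB) (by positivity)
  exact ⟨h145.1.trans hmono, h145.2.trans hmono⟩

/-- **GEOMETRIC IN THE SCALE GAP.**  Under print's choice «`M` large enough, so that `δ(M∕M₁) ≥ 2`» the old-layer profile
letter is `≤ B₃·4δ′_j·e^{−2(j−i)}` — summable over the history `j − i = 1, 2, …` uniformly in `j` (the lens's
`Σ_y |A_by|Θ_y^{eff}` over old layers is a geometric series; its arithmetic continuation to (1.48)∕(1.49) is the tree's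
`B15Ineq148Proof.ineq148_of_146_147` and `B15.BasicStep.sf149_step`, `8α ≤ 1`). [cite: Balaban1989LargeFieldI, (1.47) p.186] [bookkeeping] -/
theorem profile_oldLayer_geometric {sH sDH B₃ δ dist δ'j M M₁ gap : ℝ} (hB : 0 ≤ B₃) (hδ' : 0 ≤ δ'j)
    (hM : 2 ≤ δ * (M / M₁)) (hgap : 0 ≤ gap)
    (h145 : Ineq145 sH sDH B₃ δ dist δ'j) (h147 : Ineq147 δ dist M M₁ gap) :
    sH ≤ B₃ * Real.exp (-(2 * gap)) * (4 * δ'j) ∧ sDH ≤ B₃ * Real.exp (-(2 * gap)) * (4 * δ'j) := by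
  obtain ⟨h1, h2⟩ := profile_oldLayer_of_ineq145_147 hB hδ' h145 h147
  have hexp : Real.exp (-(δ * (M / M₁) * gap)) ≤ Real.exp (-(2 * gap)) := by
    rw [Real.exp_le_exp]; nlinarith
  have hmono : B₃ * Real.exp (-(δ * (M / M₁) * gap)) * (4 * δ'j) ≤ B₃ * Real.exp (-(2 * gap)) * (4 * δ'j) :=
    mul_le_mul_of_nonneg_right (mul_le_mul_of_nonneg_left hexp hB) (by positivity)
  exact ⟨h1.trans hmono, h2.trans hmono⟩

/-- **THE RELATIVE SIZE OF THE OLD-LAYER TILT IS SUMMABLE: `Σ_{m<n} αβ2^{−(m+1)} ≤ αβ`** — the lens's «`Σ_y|A_by|Θ_y^{eff}`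
over the history is a geometric series» in the (1.48) currency (`αβ2^{−(j−i)}`, `j − i = m + 1 ≥ 1`). [bookkeeping] -/
theorem relativeTilt_history_le {α β : ℝ} (hα : 0 ≤ α) (hβ : 0 ≤ β) (n : ℕ) :
    ∑ m ∈ Finset.range n, α * β * (1 / 2) ^ (m + 1) ≤ α * β := by
  have hgeom : ∑ m ∈ Finset.range n, ((1 : ℝ) / 2) ^ (m + 1) ≤ 1 := by
    have h := geom_sum_Ico_le_of_lt_one (show (0 : ℝ) ≤ 1 / 2 by norm_num) (show (1 : ℝ) / 2 < 1 by norm_num)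
      (m := 1) (n := n + 1)
    have hre : ∑ m ∈ Finset.range n, ((1 : ℝ) / 2) ^ (m + 1) = ∑ i ∈ Finset.Ico 1 (n + 1), ((1 : ℝ) / 2) ^ i := by
      rw [Finset.range_eq_Ico, Finset.sum_Ico_add' (fun i => ((1 : ℝ) / 2) ^ i) 0 n 1]
    rw [hre]
    refine h.trans ?_
    norm_num
  calc ∑ m ∈ Finset.range n, α * β * (1 / 2) ^ (m + 1)
      = α * β * ∑ m ∈ Finset.range n, ((1 : ℝ) / 2) ^ (m + 1) := by rw [Finset.mul_sum]
    _ ≤ α * β * 1 := mul_le_mul_of_nonneg_left hgeom (mul_nonneg hα hβ)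
    _ = α * β := mul_one _

end Dictionary

end Summit.QuantumFields.YangMills.Theorems.N21PrintedProfileDictionary
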